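import Summits.BirchSwinnertonDyer.BirchSwinnertonDyer.Theorems.SignedLowerHalvesKobayashiLowerHalfLargeImageKuriharaRigidityFacts
import HarnessLib

/-!
# Line `kurihara_rigidity` of crux `KobayashiLowerHalfLargeImage` (route `SignedLowerHalves`, item
# stmt-BirchSwinnertonDyer-19001) at the RESIDUE PRIME `p = 3`: the registered stub `stub_three` reduced to
# {an engine at 3, Kurihara's conjecture at 3 on a side condition, the crux off that side condition}
# (cell `bsd-ssimc`, seat `bsd-line-slh-p1`, lead gen 2, cycle 2; `--supports` 19001; closes nothing)

HONEST FRAMING: nothing here proves BSD or the crux; every theorem is a composition BY NAME whose open inputs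
are displayed as hypotheses. The skeleton of record (reshape r2, `Cruxes/KobayashiLowerHalfLargeImage/Lines/
kurihara_rigidity.lean`, registered b8007614) is NOT changed by this file: `stub_three` — the crux restricted to
`p = 3` verbatim — stays registered (the planner's glued-split turnkey keys on it, D33-26); this file only shows
what `stub_three` follows from.

WHY `p = 3` HAS THE SAME SHAPE AS `p ≥ 5`, `t = 0`. The line's card typed `stub_three` as «no engine: the
Kolyvagin-system rigidity engines are printed for `p > 3` only». Read at the page this is true of C.-H. Kim,
Amer. J. Math. 148 (2026) Thm 1.11 («`p ≥ 5`», held text arXiv:2203.12159 p0008) and of Castella–Sano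
arXiv:2601.14504 Thm 1 («`p > 3`»), but NOT of Kim–Kim–Sun, Selecta Math. (N.S.) 26 (2020) = arXiv:1709.05780
**Thm 1.1**, whose standing hypothesis is «Let `p > 2` be a prime» (p0003 L39; §2 p0008 L5 «Let `p` be a prime
`> 2`»), at ANY good prime (`(N,p) = 1`), with hypotheses (NA) `a_p(f) ≢ 1, ψ(p) (mod λ)` — automatic for
`a_p = 0`, `ψ = 1` —, (Im) «the image of `ρ̄` contains a conjugate of `SL₂(𝔽_p)`» — implied by `Surj` —, and
(Tam), whose first clause «corresponds to the divisibility criterion `p ∤ (∏_{q∣N_sp}(q−1))·(∏_{q∣N_ns}(q+1))`,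
`N_sp := ∏_{q∥N, a_q(f)=1} q`, `N_ns := ∏_{q∥N, a_q(f)=−1} q`» (p0004 L40–42) and whose second clause «is
automatic» «if we have `δ̃_n ≠ 0` for some `n`» (p0004 L43, Remark 2.3); conclusion «the Iwasawa main
conjecture à la Kato (Conjecture 3.3: `char_Λ(ℍ¹(T_f(1))/Λ𝐳_Kato) = char_Λ(ℍ²(T_f(1)))`) holds for
`(f, ℚ_∞/ℚ)`»; the paper's own §8.2.2 (p0022) is a `p = 3` GOOD SUPERSINGULAR example (`N = 760 = 2³·5·19`,
check «`3 ∤ (5−1)·(19+1) = 80`»). The known caveat is the tree's existing flag `KKS20@3-MR-H4`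
(`Rank1Residual/Supersingular/SharpFlatKuriharaRoute.lean`, `X8KimLargeImageOPEN.lean`): KKS Lemma 4.3 takes
Mazur–Rubin's (H.1)–(H.4) from (Im), and (H.4b) wants `p > 4`; at `p = 3` the «useful primes» step is
Sakamoto's (Doc. Math. 27 (2022) App. A; J. Théor. Nombres Bordeaux 36 (2024) 919–946). The composite binder
«KKS Thm 1.1 at `p = 3` ∘ Kobayashi 2003 Thm 7.4» is therefore typed SEPARATELY (definition-kind file
`Rank1Residual/Supersingular/KobayashiMainConjectureKuriharaRigidityThree.lean`, this seat) and enters the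
theorems below only through the DISPLAYED engine hypothesis `hE`; this file is a pure composition over an
ARBITRARY side condition `T W p` standing for (Tam), so it does not depend on that binder.

CONTENTS. `three_of_engine_of_unit_of_offSide` — `stub_three`'s registered statement from: an engine at `3`
(`hE`: good `3`, `a₃ = 0`, `Surj`, side condition, a unit Kurihara number at a cyclic Kolyvagin level for the
newform ⟹ both signed main conjectures), Kurihara's conjecture at `3` on the corner under the side condition
(`hU`: `X4.KuriharaUnitAt W 3 f`, Σ⁰₁ per pair — the `p = 3` twin of the line's HARD stub at `t = 0`), and the
crux itself off the side condition (`hR`, the honest residue); `kobayashiLowerHalfLargeImage_of_readings_of_threeEngine_OPEN`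
— the crux BY NAME from gen-1's composition `kobayashiLowerHalfLargeImage_of_kim111_of_castellaSano_readings_OPEN`
with its `p = 3` hypothesis so discharged. References: [KimKimSun2020] Thm 1.1, Rem 2.3, Lemma 4.3, §8.2.2;
[Kim2022StructureSelmer] Thm 1.11; [CastellaSano2026] Thm 1; [Kobayashi2003] Thm 7.4; [Sakamoto2022pSelmer]
App. A; [Sakamoto2024KolyvaginThree] Thm 1.1.
-/

set_option autoImplicit false

set_option linter.dupNamespace false

noncomputable section

open scoped Classical MatrixGroups ModularForm

open CongruenceSubgroup WeierstrassCurve Literature.NumberTheory.EllipticCurves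
  Literature.NumberTheory.EllipticCurves.ModularForms
  Literature.NumberTheory.EllipticCurves.Rank1Residual
  Literature.NumberTheory.EllipticCurves.Rank1Residual.Typed
  Summit.BirchSwinnertonDyer.Rank1Residual.Supersingular
  Summit.BirchSwinnertonDyer.Rank1Residual.X4

namespace Summit.BirchSwinnertonDyer.BirchSwinnertonDyer.Theorems.KuriharaRigidity

/-- **`stub_three` of line `kurihara_rigidity` (its registered statement, verbatim as the conclusion) from an
ENGINE at `3`, Kurihara's conjecture at `3` on a side condition, and the crux off it.** For an arbitrary side
condition `T W p` (standing for Kim–Kim–Sun's (Tam)): `hE` = «at `p = 3` good with `a₃ = 0`, `ρ̄` onto, `T`, a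
unit Kurihara number at a cyclic Kolyvagin level for every newform of `W` (`X4.KuriharaUnitAt`) ⟹
`KobayashiMainConjecture W 3 ε` for every sign» (the shape of KKS 2020 Thm 1.1 ∘ Kobayashi 2003 Thm 7.4 at
`p = 3`); `hU` = «on X7 ∧ ¬CM ∧ `a₃ = 0` ∧ Surj ∧ `T` at `3`, every newform of `W` has a unit Kurihara number at a
cyclic level» (Kurihara's conjecture, Σ⁰₁ per pair); `hR` = the crux's conclusion on the same corner where `T`
fails. Proof: excluded middle on `T W p`; on `T` the engine gives the main conjecture for the sign `+1`, whence
its Eisenstein half (`kobayashiLowerDivisibility_of_mainConjecture`). Pure composition; closes nothing.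
[cite: KimKimSun2020, Thm. 1.1 and §8.2.2] [cite: Kobayashi2003, Thm. 7.4 (p. 13)] -/
theorem three_of_engine_of_unit_of_offSide (T : WeierstrassCurve ℚ → ℕ → Prop)
    (hE : ∀ (W : WeierstrassCurve ℚ) [W.IsElliptic] [W.IsGloballyMinimal] (p : ℕ) [Fact p.Prime],
      p = 3 → W.HasGoodReductionAtPrime p → W.frobeniusTrace p = 0 → Surj W p → T W p →
      (∀ [NeZero (W.conductorNorm ℤ)] (f : CuspForm (Gamma0 (W.conductorNorm ℤ)) 2),
          IsNewformOf W f → KuriharaUnitAt W p f) →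
      ∀ ε : ℤˣ, KobayashiMainConjecture W p ε)
    (hU : ∀ (W : WeierstrassCurve ℚ) [W.IsElliptic] [W.IsGloballyMinimal] (p : ℕ) [Fact p.Prime],
      p = 3 → ClassX7 W p → ¬ W.HasCM → W.frobeniusTrace p = 0 → Surj W p → T W p →
      ∀ [NeZero (W.conductorNorm ℤ)] (f : CuspForm (Gamma0 (W.conductorNorm ℤ)) 2),
        IsNewformOf W f → KuriharaUnitAt W p f)
    (hR : ∀ (W : WeierstrassCurve ℚ) [W.IsElliptic] [W.IsGloballyMinimal] (p : ℕ) [Fact p.Prime],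
      p = 3 → ClassX7 W p → ¬ W.HasCM → W.frobeniusTrace p = 0 → Surj W p → ¬ T W p →
      ∃ ε : ℤˣ, KobayashiLowerDivisibility W p ε) :
    ∀ (W : WeierstrassCurve ℚ) [W.IsElliptic] [W.IsGloballyMinimal] (p : ℕ) [Fact p.Prime],
      p = 3 → ClassX7 W p → ¬ W.HasCM → W.frobeniusTrace p = 0 → Surj W p →
      ∃ ε : ℤˣ, KobayashiLowerDivisibility W p ε := by
  intro W _ _ p _ hp3 hX hcm hap hs
  by_cases hT : T W p
  · exact ⟨1, kobayashiLowerDivisibility_of_mainConjecture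
      (hE W p hp3 hX.1.1 hap hs hT (fun f hf => hU W p hp3 hX hcm hap hs hT f hf) 1)⟩
  · exact hR W p hp3 hX hcm hap hs hT

/-- **At one pair: the crux's conclusion at `p = 3` from the engine and ONE certificate.** For `W` with good
reduction at `3`, `a₃ = 0`, `ρ̄_{W,3}` onto, the side condition `T W 3`, and a unit Kurihara number at a cyclic
Kolyvagin level for every newform of `W` at level `N_W`, the engine `hE` gives `KobayashiLowerDivisibility W 3 ε`
for EVERY sign `ε` (indeed the full signed main conjecture). Per pair; closes nothing.
[cite: KimKimSun2020, Thm. 1.1] [cite: Kobayashi2003, Thm. 7.4 (p. 13)] -/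
theorem kobayashiLowerDivisibility_three_of_engine_of_kuriharaUnitAt (T : WeierstrassCurve ℚ → ℕ → Prop)
    (hE : ∀ (W : WeierstrassCurve ℚ) [W.IsElliptic] [W.IsGloballyMinimal] (p : ℕ) [Fact p.Prime],
      p = 3 → W.HasGoodReductionAtPrime p → W.frobeniusTrace p = 0 → Surj W p → T W p →
      (∀ [NeZero (W.conductorNorm ℤ)] (f : CuspForm (Gamma0 (W.conductorNorm ℤ)) 2),
          IsNewformOf W f → KuriharaUnitAt W p f) →
      ∀ ε : ℤˣ, KobayashiMainConjecture W p ε)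
    (W : WeierstrassCurve ℚ) [W.IsElliptic] [W.IsGloballyMinimal] (p : ℕ) [Fact p.Prime]
    (hp3 : p = 3) (hgood : W.HasGoodReductionAtPrime p) (hap : W.frobeniusTrace p = 0) (hs : Surj W p)
    (hT : T W p)
    (hunit : ∀ [NeZero (W.conductorNorm ℤ)] (f : CuspForm (Gamma0 (W.conductorNorm ℤ)) 2),
      IsNewformOf W f → KuriharaUnitAt W p f)
    (ε : ℤˣ) : KobayashiLowerDivisibility W p ε :=
  kobayashiLowerDivisibility_of_mainConjecture (hE W p hp3 hgood hap hs hT hunit ε)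

/-- **The crux BY NAME with its `p = 3` case on the Kurihara road** — gen 1's composition
`kobayashiLowerHalfLargeImage_of_kim111_of_castellaSano_readings_OPEN` (crux ⟸ {Kim 1.11 ∘ Ko 7.4 (PUB), CS Thm 1
∘ Ko 7.4 (PRE), CS §2 `≥` reading (PRE), GV period (PUB)} + the `≤` half of Kim's Conjecture 1.10 on X7 ∧ ¬CM ∧
Surj ∧ `p ≥ 5` + the crux at `p = 3`) with the `p = 3` hypothesis discharged by
`three_of_engine_of_unit_of_offSide`: so, modulo the named inputs and an engine at `3` of the displayed shape
(typed elsewhere as «KKS Thm 1.1 ∘ Kobayashi 7.4», flag `KKS20@3-MR-H4`), the crux's open content is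
{`≤` half on the corner at `p ≥ 5`, Kurihara's conjecture at `3` on the corner under the side condition, the
crux at `3` off the side condition}. CONDITIONAL; closes nothing; BSD is not proved by this.
[cite: Kim2022StructureSelmer, Thm. 1.11] [claim: CastellaSano2026, status: under-review]
[cite: KimKimSun2020, Thm. 1.1] [cite: Kobayashi2003, Thm. 7.4 (p. 13)] -/
theorem kobayashiLowerHalfLargeImage_of_readings_of_threeEngine_OPEN
    (hKK : Kim2026_thm111_via_kobayashi74) (hCS : CastellaSano2026_thm1_via_kobayashi74_OPEN)
    (hCSge : CastellaSano2026_sec2_tamagawaDefectGe_implicit_OPEN) (h5 : realPeriodRat_eq_unit_mul_plusPeriod)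
    (hLe : ∀ (W : WeierstrassCurve ℚ) [W.IsElliptic] [W.IsGloballyMinimal] (p : ℕ) [Fact p.Prime],
      5 ≤ p → ClassX7 W p → ¬ W.HasCM → W.frobeniusTrace p = 0 → Surj W p →
      ∀ [NeZero (W.conductorNorm ℤ)] (f : CuspForm (Gamma0 (W.conductorNorm ℤ)) 2),
        IsNewformOf W f → KimTamagawaDefectLeAt W p f)
    (T : WeierstrassCurve ℚ → ℕ → Prop)
    (hE : ∀ (W : WeierstrassCurve ℚ) [W.IsElliptic] [W.IsGloballyMinimal] (p : ℕ) [Fact p.Prime],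
      p = 3 → W.HasGoodReductionAtPrime p → W.frobeniusTrace p = 0 → Surj W p → T W p →
      (∀ [NeZero (W.conductorNorm ℤ)] (f : CuspForm (Gamma0 (W.conductorNorm ℤ)) 2),
          IsNewformOf W f → KuriharaUnitAt W p f) →
      ∀ ε : ℤˣ, KobayashiMainConjecture W p ε)
    (hU : ∀ (W : WeierstrassCurve ℚ) [W.IsElliptic] [W.IsGloballyMinimal] (p : ℕ) [Fact p.Prime],
      p = 3 → ClassX7 W p → ¬ W.HasCM → W.frobeniusTrace p = 0 → Surj W p → T W p →
      ∀ [NeZero (W.conductorNorm ℤ)] (f : CuspForm (Gamma0 (W.conductorNorm ℤ)) 2),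
        IsNewformOf W f → KuriharaUnitAt W p f)
    (hR : ∀ (W : WeierstrassCurve ℚ) [W.IsElliptic] [W.IsGloballyMinimal] (p : ℕ) [Fact p.Prime],
      p = 3 → ClassX7 W p → ¬ W.HasCM → W.frobeniusTrace p = 0 → Surj W p → ¬ T W p →
      ∃ ε : ℤˣ, KobayashiLowerDivisibility W p ε) :
    Summit.BirchSwinnertonDyer.BirchSwinnertonDyer.Theses.SignedLowerHalves.KobayashiLowerHalfLargeImage :=
  kobayashiLowerHalfLargeImage_of_kim111_of_castellaSano_readings_OPEN hKK hCS hCSge h5 hLe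
    (three_of_engine_of_unit_of_offSide T hE hU hR)

end Summit.BirchSwinnertonDyer.BirchSwinnertonDyer.Theorems.KuriharaRigidity
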